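import Summits.HodgeConjecture.HodgeConjecture.Theorems.LinearSystemTorelliLocalTubeSpanFrame

/-!
# Route LinearSystemTorelli — crux `LocalTubeSpan`: the frame theorem, partial-conclusion form

Helper file (`--supports stmt-HodgeConjecture-2490`, line `Sketch`, stub `stub_framePartial`).
The companion files `LinearSystemTorelliLocalTubeSpanFrame` / `…FrameMod` prove the formal core
of C. Schnell, *Primitive cohomology and the tube mapping*, Math. Z. 268 (2010) §7 Prop. 12 in
frame form (modulo a `G`-stable submodule `M`): when `G` is GENERATED by rank-one
direction-fixing elements (`(t - 1)A ⊆ k·e_t`, `t·e_t = e_t`) each having a positive power in the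
subgroup generated by a linearly independent rank-one frame `u_0, …, u_{r-1}` together with the
`κ` with `(κ - 1)A ⊆ M`, Schnell's third map `H¹(G, A) → ∏_g A/(g - 1)A` is injective.

At a MIXED point of the discriminant (a Janssen cluster together with transversal nodes) the local
monodromy group is generated by the cluster's meridians `s₁` AND the meridians of the nodes, and
only the former satisfy the virtual-containment hypothesis.  The present file is the
PARTIAL-CONCLUSION form of the frame theorem modulo a stable submodule, recording exactly what the
frame argument yields there, as a statement about a single undetected cocycle `φ`
(`φ g ∈ (g - 1)A` for all `g`) with no generation hypothesis:

* `localTubeSpan_exists_sub_eq_of_frame_partial` — there is ONE vector `v` with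
  `φ(u_i) = u_i·v - v` for every frame element and `φ(t) = t·v - v` for every `t ∈ s₁`, i.e.
  `φ - dv` vanishes on the frame and on `s₁`.

The line lead composes it with an "abelian tail" lemma for the nodes.  Proof = Steps 1–5 of the
proof of `localTubeSpan_injective_evalCoinv_of_frame_mod`: adjust `φ` by the coboundary of a
vector `v` obtained from undetectedness at the ordered product `u_{r-1}⋯u_0`, peel off the
`δ_i`-components by linear independence (Schnell's Lemma 9) to get vanishing on the frame, deduce
values in `M` on the subgroup generated by the frame and the `κ` (`{g | φ g ∈ M}` is a subgroup
as `M` is `G`-stable, and `φ(κ) ∈ (κ - 1)A ⊆ M`), and finally `m·φ(t) ∈ M ∩ k·e_t = 0` for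
`t ∈ s₁`, so `φ(t) = 0` in characteristic zero.  The coboundary `g ↦ g·v - v` is written out
rather than taken as Mathlib's `d₀₁ A v` (whose type pins the universe of the carrier of `A`), so
the statement is universe-polymorphic in the carrier, as the registered stub is.  The closure step
(the `FrameMod` file's `localTubeSpan_cocycles₁_apply_mem_of_mem_closure`) is inlined, that module
not being imported here.  Everything is over a field of characteristic zero and an arbitrary
group; no named facts.
-/

-- `Summit.HodgeConjecture.HodgeConjecture.Theorems` is the mandated namespace (single-conjunct summit:
-- Sub = Summit), which `linter.dupNamespace` flags on every declaration; the lakefile turns the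
-- linter off tree-wide (weak option), restated here so stand-alone elaboration is warning-free too.
set_option linter.dupNamespace false

noncomputable section

open CategoryTheory groupCohomology
open Literature.AlgebraicGeometry.HodgeTheory

namespace Summit.HodgeConjecture.HodgeConjecture.Theorems

universe u

/-- **Schnell's frame argument modulo a stable submodule, partial conclusion**
([Schnell2010] proof of Prop. 12, with the vanishing-lattice input isolated and no generation
hypothesis).  Let `G` act on the `k`-vector space `A` (`char k = 0`); let `u_0, …, u_{r-1} ∈ G` be
rank-one along linearly independent vectors `δ_i` (`(u_i - 1)A ⊆ k·δ_i`), `M` a `G`-stable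
submodule, and `s₁ ⊆ G` a set of rank-one elements fixing their direction (`(t - 1)A ⊆ k·e_t`,
`t·e_t = e_t`) with `k·e_t ∩ M = 0`, each having a positive power in the subgroup generated by the
`u_i` and all `κ ∈ G` with `(κ - 1)A ⊆ M`.  Then every undetected cocycle `φ`
(`φ g ∈ (g - 1)A` for all `g ∈ G`) is a coboundary ON THE FRAME AND ON `s₁` simultaneously: there
is one vector `v` with `φ(u_i) = u_i·v - v` for all `i` and `φ(t) = t·v - v` for all `t ∈ s₁`.
(In the crux: a mixed point of the discriminant, `s₁` the meridians of the Janssen cluster, `M`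
the radical of its local vanishing lattice.)
[cite: Schnell2010, §7 Prop. 12 (proof) and §6 Lemma 9] -/
theorem localTubeSpan_exists_sub_eq_of_frame_partial {k G : Type u} [Field k] [CharZero k]
    [Group G] (A : Rep k G) {r : ℕ} (u : Fin r → G) (δ : Fin r → A.V)
    (hδ : LinearIndependent k δ) (hu : ∀ i, subOneRange A (u i) ≤ k ∙ δ i)
    (M : Submodule k A.V) (hM : ∀ (g : G), ∀ v ∈ M, A.ρ g v ∈ M)
    (s₁ : Set G) (e : G → A.V) (hse : ∀ t ∈ s₁, subOneRange A t ≤ k ∙ e t)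
    (hfix : ∀ t ∈ s₁, A.ρ t (e t) = e t) (hMe : ∀ t ∈ s₁, (k ∙ e t) ⊓ M = ⊥)
    (hvirt : ∀ t ∈ s₁, ∃ m : ℕ, 0 < m ∧
      t ^ m ∈ Subgroup.closure (Set.range u ∪ {κ : G | subOneRange A κ ≤ M}))
    (φ : cocycles₁ A) (hφ : ∀ g : G, (φ : G → A.V) g ∈ subOneRange A g) :
    ∃ v : A.V, (∀ i, (φ : G → A.V) (u i) = A.ρ (u i) v - v) ∧
      ∀ t ∈ s₁, (φ : G → A.V) t = A.ρ t v - v := by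
  -- the ordered products `P n = u_{n-1} ⋯ u_0` (with `u_i = 1` beyond `r`)
  let ub : ℕ → G := fun i => if h : i < r then u ⟨i, h⟩ else 1
  let P : ℕ → G := fun n => Nat.rec (motive := fun _ => G) 1 (fun i g => ub i * g) n
  have hP0 : P 0 = 1 := rfl
  have hPsucc : ∀ n, P (n + 1) = ub n * P n := fun n => rfl
  have hub : ∀ i : Fin r, ub i = u i := fun i => by
    simp only [ub, dif_pos i.2]
  -- Step 1: adjust by a coboundary so that the cocycle vanishes at `P r` (the coboundary
  -- `g ↦ g·v - v` is hand-rolled: Mathlib's `d₀₁ A` would pin the universe of the carrier of `A`)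
  obtain ⟨v, hv⟩ := hφ (P r)
  have hcob : (fun g => A.ρ g v - v) ∈ cocycles₁ A := (mem_cocycles₁_iff _).2 fun g h => by
    rw [map_mul, Module.End.mul_apply, map_sub]
    abel
  set ψ : cocycles₁ A := φ - ⟨fun g => A.ρ g v - v, hcob⟩ with hψdef
  have hψapply : ∀ g, (ψ : G → A.V) g = (φ : G → A.V) g - (A.ρ g v - v) := fun g => by
    rw [hψdef]
    rfl
  have hund : ∀ g : G, (ψ : G → A.V) g ∈ subOneRange A g := fun g => by
    rw [hψapply]
    exact (subOneRange A g).sub_mem (hφ g) ⟨v, rfl⟩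
  have hψPr : (ψ : G → A.V) (P r) = 0 := by
    rw [hψapply, ← hv, LinearMap.sub_apply, LinearMap.id_apply, sub_self]
  -- it suffices to show that the adjusted cocycle vanishes on the frame and on `s₁`
  suffices hall : (∀ i, (ψ : G → A.V) (u i) = 0) ∧ ∀ t ∈ s₁, (ψ : G → A.V) t = 0 by
    refine ⟨v, fun i => ?_, fun t ht => ?_⟩
    · have := hall.1 i
      rwa [hψapply, sub_eq_zero] at this
    · have := hall.2 t ht
      rwa [hψapply, sub_eq_zero] at this
  -- the cocycle identity along the products
  have hcoc : ∀ n, (ψ : G → A.V) (P (n + 1)) = A.ρ (ub n) ((ψ : G → A.V) (P n)) +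
      (ψ : G → A.V) (ub n) := fun n => by
    rw [hPsucc, (mem_cocycles₁_iff ψ).1 ψ.2]
  -- Step 2 (Lemma 9): increments lie on the lines `k·δ_n`, partial values in the spans
  have hstep : ∀ (n : ℕ) (hn : n < r),
      (ψ : G → A.V) (P (n + 1)) - (ψ : G → A.V) (P n) ∈ k ∙ δ ⟨n, hn⟩ := fun n hn => by
    have e1 : (ψ : G → A.V) (P (n + 1)) - (ψ : G → A.V) (P n) =
        (A.ρ (u ⟨n, hn⟩) ((ψ : G → A.V) (P n)) - (ψ : G → A.V) (P n)) +
          (ψ : G → A.V) (u ⟨n, hn⟩) := by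
      rw [hcoc n, ← hub ⟨n, hn⟩]
      abel
    rw [e1]
    exact Submodule.add_mem _ (hu ⟨n, hn⟩ ⟨_, rfl⟩) (hu ⟨n, hn⟩ (hund _))
  have hspan : ∀ n, n ≤ r →
      (ψ : G → A.V) (P n) ∈ Submodule.span k (δ '' {i : Fin r | (i : ℕ) < n}) := by
    intro n
    induction n with
    | zero =>
        intro _
        rw [hP0, cocycles₁_map_one]
        exact Submodule.zero_mem _
    | succ n ih =>
        intro hn
        have hn' : n < r := Nat.lt_of_succ_le hn
        have e1 : (ψ : G → A.V) (P (n + 1)) =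
            (ψ : G → A.V) (P n) + ((ψ : G → A.V) (P (n + 1)) - (ψ : G → A.V) (P n)) := by abel
        rw [e1]
        refine Submodule.add_mem _ (Submodule.span_mono (Set.image_mono ?_) (ih hn'.le))
          (Submodule.span_mono ?_ (hstep n hn'))
        · intro i hi
          exact Nat.lt_succ_of_lt hi
        · rintro _ ⟨rfl⟩
          exact ⟨⟨n, hn'⟩, Nat.lt_succ_self n, rfl⟩
  -- Step 3: peel off, using linear independence of the `δ_i`
  have hdown : ∀ (n : ℕ) (hn : n < r), (ψ : G → A.V) (P (n + 1)) = 0 →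
      (ψ : G → A.V) (P n) = 0 := fun n hn h0 => by
    have hdisj : Disjoint (Submodule.span k (δ '' {i : Fin r | (i : ℕ) < n}))
        (Submodule.span k (δ '' {⟨n, hn⟩})) := by
      refine hδ.disjoint_span_image (Set.disjoint_left.2 ?_)
      rintro i hi rfl
      exact lt_irrefl n hi
    have hy : (ψ : G → A.V) (P n) ∈ Submodule.span k (δ '' {i : Fin r | (i : ℕ) < n}) :=
      hspan n hn.le
    have hx : -((ψ : G → A.V) (P (n + 1)) - (ψ : G → A.V) (P n)) ∈
        Submodule.span k (δ '' {⟨n, hn⟩}) := by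
      rw [Set.image_singleton]
      exact Submodule.neg_mem _ (hstep n hn)
    rw [h0, zero_sub, neg_neg] at hx
    exact (Submodule.disjoint_def.1 hdisj) _ hy hx
  have hzeroP : ∀ m, m ≤ r → (ψ : G → A.V) (P (r - m)) = 0 := by
    intro m
    induction m with
    | zero => intro _; simpa using hψPr
    | succ m ih =>
        intro hm
        have e1 : r - m = (r - (m + 1)) + 1 := by omega
        exact hdown _ (by omega) (e1 ▸ ih (Nat.le_of_succ_le hm))
  have hzeroP' : ∀ n, n ≤ r → (ψ : G → A.V) (P n) = 0 := fun n hn => by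
    have := hzeroP (r - n) (Nat.sub_le r n)
    rwa [Nat.sub_sub_self hn] at this
  -- Step 4: the cocycle vanishes on the frame, hence takes values in `M` on the subgroup
  -- generated by the frame and the `κ` with `(κ - 1)A ⊆ M`
  have hu0 : ∀ i : Fin r, (ψ : G → A.V) (u i) = 0 := fun i => by
    have := hcoc i
    rw [hzeroP' (i + 1) i.2, hzeroP' i i.2.le, map_zero, zero_add, hub] at this
    exact this.symm
  -- (`{g | ψ g ∈ M}` is a subgroup since `M` is `G`-stable; it contains the `u_i` and, by
  -- undetectedness, every `κ` with `(κ - 1)A ⊆ M`)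
  have hbig : ∀ g ∈ Subgroup.closure (Set.range u ∪ {κ : G | subOneRange A κ ≤ M}),
      (ψ : G → A.V) g ∈ M := fun g hg => by
    induction hg using Subgroup.closure_induction with
    | mem g hg =>
        rcases hg with ⟨i, rfl⟩ | hκ
        · rw [hu0 i]; exact M.zero_mem
        · exact hκ (hund _)
    | one => rw [cocycles₁_map_one]; exact M.zero_mem
    | mul g h _ _ ihg ihh =>
        rw [(mem_cocycles₁_iff ψ).1 ψ.2 g h]
        exact M.add_mem (hM g _ ihh) ihg
    | inv g _ ih =>
        have h1 : (ψ : G → A.V) g⁻¹ = -(A.ρ g⁻¹ ((ψ : G → A.V) g)) := by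
          have := congrArg (A.ρ g⁻¹) (cocycles₁_map_inv ψ g)
          rwa [Representation.inv_self_apply, map_neg] at this
        rw [h1]
        exact M.neg_mem (hM _ _ ih)
  -- Step 5: generators in `s₁` — `ψ(t) = a·e_t`, `ψ(t^m) = m·ψ(t) ∈ M ∩ k·e_t = 0`, char 0
  have hgen : ∀ t ∈ s₁, (ψ : G → A.V) t = 0 := fun t ht => by
    obtain ⟨a, ha⟩ := Submodule.mem_span_singleton.1 (hse t ht (hund t))
    have hfixψ : A.ρ t ((ψ : G → A.V) t) = (ψ : G → A.V) t := by
      rw [← ha, map_smul, hfix t ht]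
    obtain ⟨m, hm, hmem⟩ := hvirt t ht
    have h1 := localTubeSpan_cocycles₁_apply_pow_of_fix A ψ t hfixψ m
    have hinM : (m : k) • (ψ : G → A.V) t ∈ M := by rw [← h1]; exact hbig _ hmem
    have hinL : (m : k) • (ψ : G → A.V) t ∈ k ∙ e t := by
      rw [← ha, smul_smul]
      exact Submodule.smul_mem _ _ (Submodule.mem_span_singleton_self _)
    have hzero : (m : k) • (ψ : G → A.V) t = 0 := by
      have : (m : k) • (ψ : G → A.V) t ∈ (k ∙ e t) ⊓ M := ⟨hinL, hinM⟩
      rwa [hMe t ht, Submodule.mem_bot] at this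
    have hm' : (m : k) ≠ 0 := Nat.cast_ne_zero.2 (Nat.pos_iff_ne_zero.1 hm)
    exact (smul_eq_zero.1 hzero).resolve_left hm'
  exact ⟨hu0, hgen⟩

end Summit.HodgeConjecture.HodgeConjecture.Theorems

end
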